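import Mathlib
import HarnessLib
import Literature.Combinatorics.Additive.QuasiPeriodicDecompositions
import Literature.Combinatorics.Additive.QuasiProgressions

/-!
# Grynkiewicz 2009, §6 (CASE I): the `e`-transform set-up and Claim 11

[cite: Grynkiewicz2009, §6 Claim 11 (proof of Thm 4.1)] [tag: critical-pair] [tag: inverse-theorem]

Topic `Literature/Combinatorics/Additive`.  Cell `mm-stpp` (D-0046), seat `mm-stpp-lit` (gen 23); the
port of D. J. Grynkiewicz, *A step beyond Kemperman's structure theorem*, Mathematika **55** (2009)
67–114 continued.  §6, CASE I, before Claim 11 (print p. 29): «If `e + B ⊆ A` for all `e ∈ A − B`, then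
`A − B + B = A`, implying from Kneser's Theorem that `A` is periodic, a contradiction to (48).  Thus we
can choose `e ∈ A − B` such that `|(e + B) ∩ A|` is maximal subject to `|(e + B) ∩ A| < |B|`, and w.l.o.g.
(by appropriately translating `A` and `B`) we may assume `e = 0`.  Let `B(e) = (e + B) ∩ A = A ∩ B` and
`A(e) = (e + B) ∪ A = A ∪ B`.  Note that `|A(e)| + |B(e)| = |A| + |B|`, that (52)
`A(e) + B(e) ⊆ e + A + B = A + B`, and that `B(e)` is non-empty.»  **Claim 11** (p. 29): «`B(e)` is
`H`-periodic, where `H = H(A(e) + B(e))`.  Suppose that `B(e)` is not `H`-periodic … Then `B(e)` must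
have an `H`-hole `x`.  Hence, since `A(e) + B(e)` is `H`-periodic, it follows that
`(A ∪ B) + (B(e) ∪ {x}) = A(e) + (B(e) ∪ {x}) = A(e) + B(e) ⊆ A + B`.  Consequently, `x + A ⊆ A + B` and
`x + B ⊆ A + B`.  Since `x` is an `H`-hole in `B(e)`, then either `x ∉ A` or `x ∉ B`.  Hence … we can
contradict the non-extendibility of the pair `(A, B)` by either adding `x` to `A` (if `x ∉ A`) or else by
adding `x` to `B` (if `x ∉ B`).»

This file: the transform `A(e) = (e + B) ∪ A`, `B(e) = (e + B) ∩ A` for a general `e` (no translation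
to `e = 0` is needed), its three printed properties, the existence of a maximal admissible `e` (the
«Kneser» step is just: `A + (B − B) = A` with `|B| ≥ 2` exhibits a nonzero period of `A`), and Claim 11
for a general `e`: every period of `A(e) + B(e)` is a period of `B(e)`.

MAIN RESULTS (0 definitions, 0 named facts; everything PROVED; the transform is written out, no `def`).
* `Grynkiewicz2009.card_eTransform` (`|A(e)| + |B(e)| = |A| + |B|`), `eTransform_add_subset` ((52)),
  `eTransform_inter_nonempty_iff` (`B(e) ≠ ∅ ↔ e ∈ A − B`), `exists_max_eTransform` (the choice of `e`).
* `Grynkiewicz2009.addStab_eTransform_subset` — **Claim 11**: for `(A, B)` non-extendible and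
  `B(e) ≠ ∅`, `H(A(e) + B(e)) ⊆ H(B(e))`, i.e. `B(e)` is `H(A(e) + B(e))`-periodic.

## References
* D. J. Grynkiewicz, *A step beyond Kemperman's structure theorem*, Mathematika 55 (2009) 67–114,
  doi:10.1112/S0025579300000966, §6 (CASE I, p. 29: the `e`-transform and Claim 11)
  [cite: Grynkiewicz2009, Thm 4.1 (proof, Claim 11)] — held `paper:doi-10-1112-s0025579300000966`,
  p0029 read 2026-08-29.
-/

namespace Literature.Combinatorics.Additive

open Finset
open scoped Pointwise

universe u

variable {G : Type u} [AddCommGroup G] [DecidableEq G]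

namespace Grynkiewicz2009

/-! ### The transform `A(e) = (e + B) ∪ A`, `B(e) = (e + B) ∩ A` -/

/-- «Note that `|A(e)| + |B(e)| = |A| + |B|`.» [cite: Grynkiewicz2009, §6 (CASE I, p. 29)] -/
theorem card_eTransform (A B : Finset G) (e : G) :
    #((e +ᵥ B) ∪ A) + #((e +ᵥ B) ∩ A) = #A + #B := by
  rw [card_union_add_card_inter, card_vadd_finset, add_comm]

/-- «(52) `A(e) + B(e) ⊆ e + A + B`.» [cite: Grynkiewicz2009, §6 (CASE I, display (52))] -/
theorem eTransform_add_subset (A B : Finset G) (e : G) :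
    ((e +ᵥ B) ∪ A) + ((e +ᵥ B) ∩ A) ⊆ e +ᵥ (A + B) := by
  intro z hz
  obtain ⟨x, hx, y, hy, rfl⟩ := mem_add.1 hz
  rw [mem_inter] at hy
  rw [mem_union] at hx
  rcases hx with hx | hx
  · -- `x = e + b`, `y ∈ A`
    obtain ⟨b, hb, rfl⟩ := mem_vadd_finset.1 hx
    refine mem_vadd_finset.2 ⟨y + b, add_mem_add hy.2 hb, ?_⟩
    simp only [vadd_eq_add]; abel
  · -- `x ∈ A`, `y = e + b`
    obtain ⟨b, hb, rfl⟩ := mem_vadd_finset.1 hy.1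
    refine mem_vadd_finset.2 ⟨x + b, add_mem_add hx hb, ?_⟩
    simp only [vadd_eq_add]; abel

/-- «`B(e)` is non-empty» exactly when `e ∈ A − B`. [cite: Grynkiewicz2009, §6 (CASE I, p. 29)] -/
theorem eTransform_inter_nonempty_iff {A B : Finset G} {e : G} :
    ((e +ᵥ B) ∩ A).Nonempty ↔ e ∈ A - B := by
  rw [mem_sub]
  constructor
  · rintro ⟨x, hx⟩
    rw [mem_inter] at hx
    obtain ⟨b, hb, rfl⟩ := mem_vadd_finset.1 hx.1
    exact ⟨e +ᵥ b, hx.2, b, hb, by rw [vadd_eq_add, add_sub_cancel_right]⟩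
  · rintro ⟨a, ha, b, hb, rfl⟩
    refine ⟨a, mem_inter.2 ⟨mem_vadd_finset.2 ⟨b, hb, ?_⟩, ha⟩⟩
    rw [vadd_eq_add, sub_add_cancel]

/-- **The choice of `e`.**  «If `e + B ⊆ A` for all `e ∈ A − B`, then `A − B + B = A`, implying … that
`A` is periodic, a contradiction.  Thus we can choose `e ∈ A − B` such that `|(e + B) ∩ A|` is maximal
subject to `|(e + B) ∩ A| < |B|`.»  (For `|B| ≥ 2` and `A` not periodic; the difference of two elements
of `B` would be a period of `A`.) [cite: Grynkiewicz2009, §6 (CASE I, p. 29)] -/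
theorem exists_max_eTransform {A B : Finset G} (hA : A.Nonempty) (hAper : ¬ IsPeriodic A)
    (hB : 2 ≤ #B) :
    ∃ e ∈ A - B, #((e +ᵥ B) ∩ A) < #B ∧
      ∀ e' ∈ A - B, #((e' +ᵥ B) ∩ A) < #B → #((e' +ᵥ B) ∩ A) ≤ #((e +ᵥ B) ∩ A) := by
  classical
  set E := (A - B).filter fun e => #((e +ᵥ B) ∩ A) < #B with hE
  have hEne : E.Nonempty := by
    by_contra hEe
    rw [not_nonempty_iff_eq_empty] at hEe
    -- every `e ∈ A − B` has `e + B ⊆ A`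
    have hall : ∀ e ∈ A - B, e +ᵥ B ⊆ A := by
      intro e he
      have hnot : ¬ #((e +ᵥ B) ∩ A) < #B := fun hlt => by
        have : e ∈ E := mem_filter.2 ⟨he, hlt⟩
        rw [hEe] at this
        exact notMem_empty e this
      have hle : #(e +ᵥ B) ≤ #((e +ᵥ B) ∩ A) := by rw [card_vadd_finset]; omega
      have := eq_of_subset_of_card_le inter_subset_left hle
      rw [← this]; exact inter_subset_right
    -- two elements of `B` give a nonzero period of `A`
    obtain ⟨b₁, hb₁, b₂, hb₂, hne⟩ := one_lt_card.1 (by omega : 1 < #B)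
    apply hAper
    rw [isPeriodic_iff_addStab_ne hA]
    intro h0
    have hmem : b₁ - b₂ ∈ A.addStab := by
      rw [mem_addStab hA]
      refine eq_of_subset_of_card_le (fun x hx => ?_) (by rw [card_vadd_finset])
      obtain ⟨a, ha, rfl⟩ := mem_vadd_finset.1 hx
      have he : a - b₂ ∈ A - B := mem_sub.2 ⟨a, ha, b₂, hb₂, rfl⟩
      refine hall _ he (mem_vadd_finset.2 ⟨b₁, hb₁, ?_⟩)
      simp only [vadd_eq_add]; abel
    rw [h0, mem_singleton, sub_eq_zero] at hmem
    exact hne hmem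
  obtain ⟨e, heE, hmax⟩ := exists_max_image E (fun e => #((e +ᵥ B) ∩ A)) hEne
  rw [mem_filter] at heE
  exact ⟨e, heE.1, heE.2, fun e' he' hlt => hmax e' (mem_filter.2 ⟨he', hlt⟩)⟩

/-! ### Claim 11: `B(e)` is `H(A(e) + B(e))`-periodic -/

/-- **§6 Claim 11.**  For `(A, B)` non-extendible and `B(e) = (e + B) ∩ A ≠ ∅`: every period of
`A(e) + B(e)` is a period of `B(e)` (`H(A(e) + B(e)) ⊆ H(B(e))`), i.e. `B(e)` is `H`-periodic for
`H = H(A(e) + B(e))`.  Proof as printed, for a general `e`: an `H`-hole `x = h + y` (`y ∈ B(e)`) of `B(e)`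
has `A(e) + x ⊆ h + (A(e) + B(e)) = A(e) + B(e) ⊆ e + A + B`; with `e + B ⊆ A(e)` this gives
`x + B ⊆ A + B`, and with `A ⊆ A(e)` it gives `(x − e) + A ⊆ A + B`; since `x ∉ B(e)`, either `x ∉ A`
(and adding `x` to `A` does not change `A + B`) or `x − e ∉ B` (and adding `x − e` to `B` does not change
`A + B`) — contradicting non-extendibility. [cite: Grynkiewicz2009, §6 Claim 11 (proof of Thm 4.1, p. 29)] -/
theorem addStab_eTransform_subset {A B : Finset G} (e : G) (hneA : IsNonExtendible A B)
    (hneB : IsNonExtendible B A) (hne : ((e +ᵥ B) ∩ A).Nonempty) :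
    (((e +ᵥ B) ∪ A) + ((e +ᵥ B) ∩ A)).addStab ⊆ ((e +ᵥ B) ∩ A).addStab := by
  intro h hh
  have hSne : (((e +ᵥ B) ∪ A) + ((e +ᵥ B) ∩ A)).Nonempty :=
    (hne.mono inter_subset_right).mono subset_union_right |>.add hne
  rw [mem_addStab hSne] at hh
  rw [mem_addStab hne]
  refine eq_of_subset_of_card_le (fun x hx => ?_) (by rw [card_vadd_finset])
  obtain ⟨y, hy, rfl⟩ := mem_vadd_finset.1 hx
  by_contra hxBe
  -- `A(e) + (h + y) ⊆ h + (A(e) + B(e)) = A(e) + B(e) ⊆ e + (A + B)`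
  have hsub : ∀ z ∈ (e +ᵥ B) ∪ A, z + (h +ᵥ y) ∈ e +ᵥ (A + B) := fun z hz => by
    have : z + (h +ᵥ y) ∈ h +ᵥ (((e +ᵥ B) ∪ A) + ((e +ᵥ B) ∩ A)) :=
      mem_vadd_finset.2 ⟨z + y, add_mem_add hz hy, by simp only [vadd_eq_add]; abel⟩
    rw [hh] at this
    exact eTransform_add_subset A B e this
  rw [mem_inter, not_and_or] at hxBe
  rcases hxBe with hxB | hxA
  · -- `x ∉ e + B`: add `x − e` to `B`
    have hx' : -e + (h +ᵥ y) ∉ B := fun hmem => hxB (mem_vadd_finset.2 ⟨_, hmem, by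
      simp only [vadd_eq_add]; abel⟩)
    apply hneB _ hx'
    refine Subset.antisymm ?_ (add_subset_add_right (subset_insert _ _))
    intro z hz
    obtain ⟨u, hu, a, ha, rfl⟩ := mem_add.1 hz
    rw [mem_insert] at hu
    rcases hu with rfl | hu
    · have := hsub a (mem_union_right _ ha)
      obtain ⟨w, hw, hwe⟩ := mem_vadd_finset.1 this
      rw [add_comm B A]
      have e1 : -e + (h +ᵥ y) + a = w := by
        simp only [vadd_eq_add] at hwe ⊢
        have : w = a + (h + y) - e := by rw [← hwe]; abel
        rw [this]; abel
      rw [e1]; exact hw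
    · exact add_mem_add hu ha
  · -- `x ∉ A`: add `x` to `A`
    apply hneA _ hxA
    refine Subset.antisymm ?_ (add_subset_add_right (subset_insert _ _))
    intro z hz
    obtain ⟨u, hu, b, hb, rfl⟩ := mem_add.1 hz
    rw [mem_insert] at hu
    rcases hu with rfl | hu
    · have := hsub (e +ᵥ b) (mem_union_left _ (mem_vadd_finset.2 ⟨b, hb, rfl⟩))
      obtain ⟨w, hw, hwe⟩ := mem_vadd_finset.1 this
      have e1 : (h +ᵥ y) + b = w := by
        simp only [vadd_eq_add] at hwe ⊢
        have : w = e + b + (h + y) - e := by rw [← hwe]; abel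
        rw [this]; abel
      rw [e1]; exact hw
    · exact add_mem_add hu hb

/-- Claim 11 in words: `B(e)` is `H`-periodic for the stabilizer subgroup `H` of `A(e) + B(e)`.
[cite: Grynkiewicz2009, §6 Claim 11] -/
theorem isPeriodicWith_eTransform_inter {A B : Finset G} (e : G) (hneA : IsNonExtendible A B)
    (hneB : IsNonExtendible B A) (hne : ((e +ᵥ B) ∩ A).Nonempty) :
    IsPeriodicWith (AddAction.stabilizer G (((e +ᵥ B) ∪ A) + ((e +ᵥ B) ∩ A))) ((e +ᵥ B) ∩ A) := by
  intro h hh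
  have hSne : (((e +ᵥ B) ∪ A) + ((e +ᵥ B) ∩ A)).Nonempty :=
    (hne.mono inter_subset_right).mono subset_union_right |>.add hne
  have hh' : h ∈ (((e +ᵥ B) ∪ A) + ((e +ᵥ B) ∩ A)).addStab := by
    rw [mem_addStab hSne]; exact AddAction.mem_stabilizer_iff.1 hh
  have := addStab_eTransform_subset e hneA hneB hne hh'
  rwa [mem_addStab hne] at this

end Grynkiewicz2009

end Literature.Combinatorics.Additive
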